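import Summits.QuantumFields.QCD.Theses.HeatSlicedQuarks
import Summits.QuantumFields.QCD.Theorems.HeatSlicedQuarksInterleavedHeatSliceFlowStubCoveringPeriodization

/-!
# Stub `stub_periodizationAssembly` of line `Sketch` (crux `InterleavedHeatSliceFlow`, item stmt-QuantumFields-8891)

**Assembly of the log-regime parametrix core** `ParametrixCoreLog` from the three named inputs of
reshape r4, written out: `OffDiagLogProfile → ImageSum → InteriorIdentification → ParametrixCoreLog`.

With `H_V = D_W(V)ᴴ D_W(V)` (Wilson parameter `r = 1`) and `K_V(t) = exp(-t H_V)` on the discrete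
four-torus `T_L`, the claim is: under GLOBAL `(ε/r²)²`-smallness of the plaquette deficits of `U`,
for `1 ≤ t ≤ r²` in the regime `t (1 + log t)² ≤ L²`,

  `|K_U(t)((x,a,α),(x,b,β)) - K_1(t)((x,a,α),(x,b,β))| ≤ C (ε t / r²) / t²`.

## Proof (pure bookkeeping; all inputs are hypotheses or landed)

* Constants: `ε := min ε_off ε₀`, `C := C_int + 2 (max C_off 0) (max C_img 0) / ε`.
* Cover: choose `N ≥ 1` with `A r²/ε ≤ N` and pass to the `N⁴`-sheeted cover
  `π : T_{NL} → T_L` (coordinatewise `ZMod.castHom`); lift `x` to `x̃` (`π x̃ = x`, `exists_lift`).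
  The landed `stub_coveringPeriodization`, for `U` and for `U ≡ 1`, writes both on-diagonal kernels
  on `T_L` as fibre sums `Σ_{π z̃ = x} K(t)((x̃,a,α),(z̃,b,β))` of the kernels of the pulled-back
  fields on `T_{NL}`; the pull-back of the constant field is the constant field.
* The pulled-back field has the same plaquette holonomies (`plaquetteHolonomy_pull`, from
  `π (ỹ + μ̂) = π ỹ + μ̂`), hence the same global smallness; the constant field has deficit `0`.
* Fibre term `z̃ = x̃`: `InteriorIdentification` on `T_{NL}` (`A r²/ε ≤ N ≤ NL`) gives
  `C_int (ε t/r²)/t²`.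
* Deck images `z̃ ≠ x̃`: both kernels are bounded entrywise by `OffDiagLogProfile` on `T_{NL}`,
  `(max C_off 0)/t² · (1 + d²/(tℓ))⁻³` with `ℓ = 1 + log t ≥ 1`, and the image sum is `ImageSum`
  with `θ = tℓ`: `≤ (max C_img 0) (tℓ/L²)³`.
* Regime arithmetic (`regime_cube_le`): `tℓ² ≤ L²`, `ℓ ≥ 1`, `r ≤ L` give
  `(tℓ/L²)³ ≤ t/(ℓL²) ≤ t/r²`, so the images contribute
  `2 (max C_off 0)(max C_img 0) (t/r²)/t² = [2 (max C_off 0)(max C_img 0)/ε] (ε t/r²)/t²`.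

Leans on: `stub_coveringPeriodization` (landed), the tree definitions `plaquetteHolonomy`,
`Site.shift`, and Mathlib (`ZMod.castHom`, `Finset` algebra, `Real.log_nonneg`).  No named facts.
-/

namespace Summit.QuantumFields.QCD.Cruxes.InterleavedHeatSliceFlow.Sketch

open Literature.MathematicalPhysics.QuantumLattice Literature.MathematicalPhysics.QuantumFieldTheory
  Literature.Probability.LatticeModels
open Summit.QuantumFields.QCD.Theses.HeatSlicedQuarks
open scoped Matrix

/-! ### Real-number bookkeeping -/

/-- Regime arithmetic: from `t ℓ² ≤ L²`, `ℓ ≥ 1`, `0 < r² ≤ L²` and `0 ≤ t` we get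
`(t ℓ / L²)³ ≤ t / r²` (indeed `u := tℓ/L²` satisfies `u ℓ ≤ 1`, so `u³ L² = t (uℓ) u ≤ t`). -/
private theorem regime_cube_le {t ℓ Lsq rsq : ℝ} (ht : 0 ≤ t) (hℓ : 1 ≤ ℓ) (hrsq : 0 < rsq)
    (hrL : rsq ≤ Lsq) (hreg : t * ℓ ^ 2 ≤ Lsq) : (t * ℓ / Lsq) ^ 3 ≤ t / rsq := by
  have hL : 0 < Lsq := lt_of_lt_of_le hrsq hrL
  set u := t * ℓ / Lsq with hu
  have hu0 : 0 ≤ u := div_nonneg (mul_nonneg ht (zero_le_one.trans hℓ)) hL.le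
  have huℓ : u * ℓ ≤ 1 := by
    rw [hu, div_mul_eq_mul_div, div_le_one hL]
    calc t * ℓ * ℓ = t * ℓ ^ 2 := by ring
      _ ≤ Lsq := hreg
  have hu1 : u ≤ 1 := (le_mul_of_one_le_right hu0 hℓ).trans huℓ
  have huL : u * Lsq = t * ℓ := div_mul_cancel₀ _ hL.ne'
  calc u ^ 3 ≤ t / Lsq := by
        rw [le_div_iff₀ hL]
        calc u ^ 3 * Lsq = u * Lsq * u * u := by ring
          _ = t * (u * ℓ) * u := by rw [huL]; ring
          _ ≤ t * 1 * 1 := mul_le_mul (mul_le_mul_of_nonneg_left huℓ ht) hu1 hu0 (by positivity)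
          _ = t := by ring
    _ ≤ t / rsq := div_le_div_of_nonneg_left ht hrsq hrL

/-- Entrywise bookkeeping for the deck images: two profile bounds `‖F z‖, ‖G z‖ ≤ C/t² · w z` with
`w ≥ 0` sum to `Σ ‖F z - G z‖ ≤ 2 (max C 0 / t²) Σ w z`. -/
private theorem sum_norm_sub_le {ι : Type*} (s : Finset ι) (F G : ι → ℂ) (w : ι → ℝ) {C t : ℝ}
    (hw : ∀ z ∈ s, 0 ≤ w z) (hF : ∀ z ∈ s, ‖F z‖ ≤ C / t ^ 2 * w z)
    (hG : ∀ z ∈ s, ‖G z‖ ≤ C / t ^ 2 * w z) :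
    ∑ z ∈ s, ‖F z - G z‖ ≤ 2 * (max C 0 / t ^ 2) * ∑ z ∈ s, w z := by
  rw [Finset.mul_sum]
  refine Finset.sum_le_sum fun z hz => ?_
  have hCt : C / t ^ 2 ≤ max C 0 / t ^ 2 :=
    div_le_div_of_nonneg_right (le_max_left C 0) (sq_nonneg t)
  calc ‖F z - G z‖ ≤ ‖F z‖ + ‖G z‖ := norm_sub_le _ _
    _ ≤ C / t ^ 2 * w z + C / t ^ 2 * w z := add_le_add (hF z hz) (hG z hz)
    _ ≤ max C 0 / t ^ 2 * w z + max C 0 / t ^ 2 * w z :=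
        add_le_add (mul_le_mul_of_nonneg_right hCt (hw z hz))
          (mul_le_mul_of_nonneg_right hCt (hw z hz))
    _ = 2 * (max C 0 / t ^ 2) * w z := by ring

/-- The fibre split: if `K_U = Σ_{z ∈ s} F z` and `K_1 = Σ_{z ∈ s} G z` (periodization), `a ∈ s`
(the diagonal lift), the images `z ≠ a` obey the profile bounds of `sum_norm_sub_le` with
`Σ_{z ≠ a} w z ≤ B₁`, and the diagonal term obeys `‖F a - G a‖ ≤ B₀`, then
`‖K_U - K_1‖ ≤ B₀ + 2 (max C 0 / t²) B₁`. -/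
private theorem fibre_assembly {ι : Type*} [DecidableEq ι] {s : Finset ι} {a : ι} (ha : a ∈ s)
    {F G : ι → ℂ} {KU K1 : ℂ} (hU : KU = ∑ z ∈ s, F z) (h1 : K1 = ∑ z ∈ s, G z)
    {w : ι → ℝ} {C t B₀ B₁ : ℝ}
    (hF : ∀ z ∈ s.erase a, ‖F z‖ ≤ C / t ^ 2 * w z) (hG : ∀ z ∈ s.erase a, ‖G z‖ ≤ C / t ^ 2 * w z)
    (hw : ∀ z ∈ s.erase a, 0 ≤ w z) (h0 : ‖F a - G a‖ ≤ B₀) (hsum : ∑ z ∈ s.erase a, w z ≤ B₁) :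
    ‖KU - K1‖ ≤ B₀ + 2 * (max C 0 / t ^ 2) * B₁ := by
  rw [hU, h1, ← Finset.sum_sub_distrib, ← Finset.add_sum_erase s _ ha]
  refine (norm_add_le _ _).trans (add_le_add h0 ((norm_sum_le _ _).trans ?_))
  refine (sum_norm_sub_le (s.erase a) F G w hw hF hG).trans ?_
  exact mul_le_mul_of_nonneg_left hsum (by positivity)

/-! ### The cover `T_{NL} → T_L` -/

/-- Every site of the base torus lifts to the cover: `π x̃ = x` for `x̃ μ := (x μ).val`. -/
private theorem exists_lift (N L : ℕ) [NeZero L] (x : TorusSite 4 L) :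
    ∃ z : TorusSite 4 (N * L), (fun μ => ZMod.castHom (dvd_mul_left L N) (ZMod L) (z μ)) = x :=
  ⟨fun μ => ((x μ).val : ZMod (N * L)), funext fun μ =>
    (map_natCast _ (x μ).val).trans (ZMod.natCast_zmod_val (x μ))⟩

/-- The coordinatewise reduction `π : (ℤ/NLℤ)⁴ → (ℤ/Lℤ)⁴` commutes with the unit shifts:
`π (x + μ̂) = π x + μ̂` (re-proved; it is private in the periodization file). -/
private theorem castHom_shift' (N L : ℕ) (x : TorusSite 4 (N * L)) (μ : Fin 4) :
    (fun ν => ZMod.castHom (dvd_mul_left L N) (ZMod L) (Site.shift x μ ν)) =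
      Site.shift (fun ν => ZMod.castHom (dvd_mul_left L N) (ZMod L) (x ν)) μ := by
  funext ν
  simp only [Literature.MathematicalPhysics.QuantumFieldTheory.Site.shift, Pi.add_apply, map_add,
    Pi.single_apply]
  split_ifs <;> simp

/-- Plaquette holonomies of a pulled-back configuration are the pulled-back plaquette holonomies:
`(U ∘ π)_p(ỹ; μ, ν) = U_p(π ỹ; μ, ν)` whenever `π` commutes with the unit shifts. -/
private theorem plaquetteHolonomy_pull {G : Type*} [Group G] {L L' : ℕ}
    (π : TorusSite 4 L' → TorusSite 4 L) (hπ : ∀ x μ, π (Site.shift x μ) = Site.shift (π x) μ)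
    (U : GaugeConfig 4 L G) (y : TorusSite 4 L') (μ ν : Fin 4) :
    plaquetteHolonomy (fun e : Edge 4 L' => U (π e.1, e.2)) y μ ν =
      plaquetteHolonomy U (π y) μ ν := by
  simp only [plaquetteHolonomy, hπ]

/-- Global plaquette smallness descends to the cover: the pulled-back field `U ∘ π` on `T_{NL}` has
the same deficit bound as `U` on `T_L`. -/
private theorem small_pull (N L : ℕ) (U : GaugeConfig 4 L (Matrix.specialUnitaryGroup (Fin 3) ℂ))
    {δ : ℝ} (h : ∀ (y : TorusSite 4 L) (μ ν : Fin 4),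
      3 - ((fundamentalRep (Fin 3)) (plaquetteHolonomy U y μ ν)).trace.re ≤ δ)
    (y : TorusSite 4 (N * L)) (μ ν : Fin 4) :
    3 - ((fundamentalRep (Fin 3)) (plaquetteHolonomy
      (fun e : Edge 4 (N * L) =>
        U ((fun μ => ZMod.castHom (dvd_mul_left L N) (ZMod L) (e.1 μ)), e.2)) y μ ν)).trace.re ≤ δ := by
  have key := plaquetteHolonomy_pull
    (fun (z : TorusSite 4 (N * L)) μ => ZMod.castHom (dvd_mul_left L N) (ZMod L) (z μ))
    (castHom_shift' N L) U y μ ν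
  rw [key]
  exact h _ μ ν

/-- The constant configuration `U ≡ 1` has trivial plaquette holonomies, hence deficit `0 ≤ δ`. -/
private theorem small_free {L' : ℕ} {δ : ℝ} (hδ : 0 ≤ δ) (y : TorusSite 4 L') (μ ν : Fin 4) :
    3 - ((fundamentalRep (Fin 3)) (plaquetteHolonomy
      (fun _ : Edge 4 L' => (1 : Matrix.specialUnitaryGroup (Fin 3) ℂ)) y μ ν)).trace.re ≤ δ := by
  have hdef : (3 : ℝ) - ((fundamentalRep (Fin 3)) (plaquetteHolonomy
      (fun _ : Edge 4 L' => (1 : Matrix.specialUnitaryGroup (Fin 3) ℂ)) y μ ν)).trace.re = 0 := by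
    simp only [plaquetteHolonomy, mul_one, inv_one, map_one, Matrix.trace_one, Fintype.card_fin]
    norm_num
  rw [hdef]
  exact hδ

/-- The deck images of `x̃` in its own fibre: removing `x̃` from the fibre `π⁻¹(π x̃)` leaves the
index set of `ImageSum`. -/
private theorem fibre_erase_eq (N L : ℕ) [NeZero (N * L)] (x : TorusSite 4 (N * L)) :
    (Finset.univ.filter fun z : TorusSite 4 (N * L) =>
        (fun μ => ZMod.castHom (dvd_mul_left L N) (ZMod L) (z μ)) =
          fun μ => ZMod.castHom (dvd_mul_left L N) (ZMod L) (x μ)).erase x =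
      Finset.univ.filter fun z : TorusSite 4 (N * L) =>
        (fun μ => ZMod.castHom (dvd_mul_left L N) (ZMod L) (z μ)) =
          (fun μ => ZMod.castHom (dvd_mul_left L N) (ZMod L) (x μ)) ∧ z ≠ x := by
  ext z
  simp only [Finset.mem_erase, Finset.mem_filter, Finset.mem_univ, true_and]
  exact and_comm

/-! ### The assembly -/

/-- **Stub `stub_periodizationAssembly`** (M/L; reshape r4; worker):
`OffDiagLogProfile → ImageSum → InteriorIdentification → ParametrixCoreLog`, written out.
With `ε := min ε_off ε₀` and `C := C_int + 2 (max C_off 0)(max C_img 0)/ε`: choose `N ≥ 1` with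
`A r²/ε ≤ N`, lift `x` to `x̃ ∈ T_{NL}`; `stub_coveringPeriodization` for `U` and for `U ≡ 1`
writes `ΔK^{T_L}(t)(x,x)` as the fibre sum of `ΔK^{T_{NL}}(t)(x̃,z̃)`; the pulled-back field has
the same plaquette deficits; the term `z̃ = x̃` is `InteriorIdentification` on `T_{NL}`
(`A r²/ε ≤ N ≤ NL`); the images are bounded entrywise by `OffDiagLogProfile` (both kernels) and
summed by `ImageSum` with `θ = t(1+log t)`, and `(θ/L²)³ ≤ t/L² ≤ t/r²` in the regime
`t(1+log t)² ≤ L²`.  Leans on: `stub_coveringPeriodization` (landed), `plaquetteHolonomy`,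
`Site.shift`, Mathlib. -/
theorem stub_periodizationAssembly :
    (∃ ε : ℝ, 0 < ε ∧ ∃ C : ℝ, ∀ (L : ℕ) [NeZero L]
      (U : GaugeConfig 4 L (Matrix.specialUnitaryGroup (Fin 3) ℂ)) (m : ℝ), m ∈ Set.Icc (-(1 / 2 : ℝ)) 1 →
      ∀ (r : ℕ), 1 ≤ r → r ≤ L →
      (∀ (y : TorusSite 4 L) (μ ν : Fin 4),
        3 - ((fundamentalRep (Fin 3)) (plaquetteHolonomy U y μ ν)).trace.re ≤ (ε / (r : ℝ) ^ 2) ^ 2) →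
      ∀ (t : ℝ), 1 ≤ t → t ≤ (r : ℝ) ^ 2 → ∀ (x y : TorusSite 4 L) (a b : Fin 3) (α β : Fin 4),
        ‖(NormedSpace.exp (-(t : ℂ) • ((wilsonDirac (fundamentalRep (Fin 3)) U m 1)ᴴ *
              wilsonDirac (fundamentalRep (Fin 3)) U m 1))) (x, a, α) (y, b, β)‖ ≤
          C / t ^ 2 * ((1 + (torusDist x y : ℝ) ^ 2 / (t * (1 + Real.log t))) ^ 3)⁻¹) →
    (∃ C : ℝ, ∀ (N L : ℕ) [NeZero L] [NeZero (N * L)] (x : TorusSite 4 (N * L)) (θ : ℝ), 0 < θ →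
      ∑ z ∈ Finset.univ.filter (fun z : TorusSite 4 (N * L) =>
          (fun μ => ZMod.castHom (dvd_mul_left L N) (ZMod L) (z μ)) =
            (fun μ => ZMod.castHom (dvd_mul_left L N) (ZMod L) (x μ)) ∧ z ≠ x),
        ((1 + (torusDist x z : ℝ) ^ 2 / θ) ^ 3)⁻¹ ≤ C * (θ / (L : ℝ) ^ 2) ^ 3) →
    (∃ ε₀ : ℝ, 0 < ε₀ ∧ ∃ A C : ℝ, ∀ (L : ℕ) [NeZero L]
      (U : GaugeConfig 4 L (Matrix.specialUnitaryGroup (Fin 3) ℂ)) (m : ℝ), m ∈ Set.Icc (-(1 / 2 : ℝ)) 1 →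
      ∀ (r : ℕ), 1 ≤ r → r ≤ L → ∀ (ε : ℝ), 0 < ε → ε ≤ ε₀ →
      (∀ (y : TorusSite 4 L) (μ ν : Fin 4),
        3 - ((fundamentalRep (Fin 3)) (plaquetteHolonomy U y μ ν)).trace.re ≤ (ε / (r : ℝ) ^ 2) ^ 2) →
      A * (r : ℝ) ^ 2 / ε ≤ (L : ℝ) →
      ∀ (t : ℝ), 1 ≤ t → t ≤ (r : ℝ) ^ 2 → ∀ (x : TorusSite 4 L) (a b : Fin 3) (α β : Fin 4),
        ‖(NormedSpace.exp (-(t : ℂ) • ((wilsonDirac (fundamentalRep (Fin 3)) U m 1)ᴴ *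
              wilsonDirac (fundamentalRep (Fin 3)) U m 1))) (x, a, α) (x, b, β) -
            (NormedSpace.exp (-(t : ℂ) •
              ((wilsonDirac (fundamentalRep (Fin 3))
                  (fun _ : Edge 4 L => (1 : Matrix.specialUnitaryGroup (Fin 3) ℂ)) m 1)ᴴ *
                wilsonDirac (fundamentalRep (Fin 3))
                  (fun _ : Edge 4 L => (1 : Matrix.specialUnitaryGroup (Fin 3) ℂ)) m 1))) (x, a, α) (x, b, β)‖ ≤
          C * (ε * t / (r : ℝ) ^ 2) / t ^ 2) →
    (∃ ε : ℝ, 0 < ε ∧ ∃ C : ℝ, ∀ (L : ℕ) [NeZero L]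
      (U : GaugeConfig 4 L (Matrix.specialUnitaryGroup (Fin 3) ℂ)) (m : ℝ), m ∈ Set.Icc (-(1 / 2 : ℝ)) 1 →
      ∀ (r : ℕ), 1 ≤ r → r ≤ L →
      (∀ (y : TorusSite 4 L) (μ ν : Fin 4),
        3 - ((fundamentalRep (Fin 3)) (plaquetteHolonomy U y μ ν)).trace.re ≤ (ε / (r : ℝ) ^ 2) ^ 2) →
      ∀ (t : ℝ), 1 ≤ t → t ≤ (r : ℝ) ^ 2 → t * (1 + Real.log t) ^ 2 ≤ (L : ℝ) ^ 2 →
      ∀ (x : TorusSite 4 L) (a b : Fin 3) (α β : Fin 4),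
        ‖(NormedSpace.exp (-(t : ℂ) • ((wilsonDirac (fundamentalRep (Fin 3)) U m 1)ᴴ *
              wilsonDirac (fundamentalRep (Fin 3)) U m 1))) (x, a, α) (x, b, β) -
            (NormedSpace.exp (-(t : ℂ) •
              ((wilsonDirac (fundamentalRep (Fin 3))
                  (fun _ : Edge 4 L => (1 : Matrix.specialUnitaryGroup (Fin 3) ℂ)) m 1)ᴴ *
                wilsonDirac (fundamentalRep (Fin 3))
                  (fun _ : Edge 4 L => (1 : Matrix.specialUnitaryGroup (Fin 3) ℂ)) m 1))) (x, a, α) (x, b, β)‖ ≤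
          C * (ε * t / (r : ℝ) ^ 2) / t ^ 2) := by
  rintro ⟨ε₁, hε₁, C₁, hOff⟩ ⟨C₂, hImg⟩ ⟨ε₀, hε₀, A, C₃, hInt⟩
  -- constants
  obtain ⟨ε, hε, hεle₁, hεle₀⟩ : ∃ ε : ℝ, 0 < ε ∧ ε ≤ ε₁ ∧ ε ≤ ε₀ :=
    ⟨min ε₁ ε₀, lt_min hε₁ hε₀, min_le_left _ _, min_le_right _ _⟩
  refine ⟨ε, hε, C₃ + 2 * max C₁ 0 * max C₂ 0 / ε, ?_⟩
  intro L _ U m hm r hr hrL hsmall t ht htr hreg x a b α β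
  -- positivity bookkeeping
  have hr0 : (0 : ℝ) < (r : ℝ) := by exact_mod_cast Nat.lt_of_lt_of_le Nat.zero_lt_one hr
  have hr2 : (0 : ℝ) < (r : ℝ) ^ 2 := by positivity
  have ht0 : (0 : ℝ) < t := lt_of_lt_of_le one_pos ht
  have hℓ : (1 : ℝ) ≤ 1 + Real.log t := le_add_of_nonneg_right (Real.log_nonneg ht)
  have hℓ0 : (0 : ℝ) < 1 + Real.log t := lt_of_lt_of_le one_pos hℓ
  have hθ : (0 : ℝ) < t * (1 + Real.log t) := mul_pos ht0 hℓ0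
  have hL1 : (1 : ℝ) ≤ (L : ℝ) := by exact_mod_cast hr.trans hrL
  have hrL' : (r : ℝ) ^ 2 ≤ (L : ℝ) ^ 2 := pow_le_pow_left₀ hr0.le (by exact_mod_cast hrL) 2
  -- smallness is monotone in `ε`
  have hmono : ∀ ε' : ℝ, ε ≤ ε' → ∀ (y : TorusSite 4 L) (μ ν : Fin 4),
      3 - ((fundamentalRep (Fin 3)) (plaquetteHolonomy U y μ ν)).trace.re ≤
        (ε' / (r : ℝ) ^ 2) ^ 2 := by
    intro ε' hle y μ ν
    refine (hsmall y μ ν).trans ?_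
    have h1 : 0 ≤ ε / (r : ℝ) ^ 2 := div_nonneg hε.le hr2.le
    have h2 : ε / (r : ℝ) ^ 2 ≤ ε' / (r : ℝ) ^ 2 := div_le_div_of_nonneg_right hle hr2.le
    exact pow_le_pow_left₀ h1 h2 2
  -- the cover degree `N ≥ 1` with `A r²/ε ≤ N ≤ N L`
  obtain ⟨N, hN, hAN⟩ : ∃ N : ℕ, 0 < N ∧ A * (r : ℝ) ^ 2 / ε ≤ (N : ℝ) :=
    ⟨⌈A * (r : ℝ) ^ 2 / ε⌉₊ + 1, Nat.succ_pos _,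
      (Nat.le_ceil _).trans (Nat.cast_le.2 (Nat.le_succ _))⟩
  haveI : NeZero (N * L) := ⟨Nat.mul_ne_zero hN.ne' (NeZero.ne L)⟩
  have hrNL : r ≤ N * L := hrL.trans (Nat.le_mul_of_pos_left L hN)
  have hANL : A * (r : ℝ) ^ 2 / ε ≤ ((N * L : ℕ) : ℝ) := by
    rw [Nat.cast_mul]
    exact hAN.trans (le_mul_of_one_le_right (Nat.cast_nonneg N) hL1)
  -- lift `x` to the cover: from now on `x = π xt`
  obtain ⟨xt, rfl⟩ := exists_lift N L x
  have hmem : xt ∈ Finset.univ.filter (fun z : TorusSite 4 (N * L) =>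
      (fun μ => ZMod.castHom (dvd_mul_left L N) (ZMod L) (z μ)) =
        fun μ => ZMod.castHom (dvd_mul_left L N) (ZMod L) (xt μ)) :=
    Finset.mem_filter.2 ⟨Finset.mem_univ _, rfl⟩
  -- the image sum, in the regime
  have hI := hImg N L xt (t * (1 + Real.log t)) hθ
  rw [← fibre_erase_eq N L xt] at hI
  have hsum := hI.trans ((mul_le_mul_of_nonneg_right (le_max_left C₂ 0) (by positivity)).trans
    (mul_le_mul_of_nonneg_left (regime_cube_le ht0.le hℓ hr2 hrL' hreg) (le_max_right C₂ 0)))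
  -- periodize both kernels, split the fibre, bound the diagonal lift and the images
  refine (fibre_assembly hmem (stub_coveringPeriodization N L U m t xt _ a b α β)
    (stub_coveringPeriodization N L
      (fun _ : Edge 4 L => (1 : Matrix.specialUnitaryGroup (Fin 3) ℂ)) m t xt _ a b α β)
    (fun z _ => hOff (N * L) _ m hm r hr hrNL (small_pull N L U (hmono ε₁ hεle₁)) t ht htr
      xt z a b α β)
    (fun z _ => hOff (N * L) _ m hm r hr hrNL (fun y μ ν => small_free (by positivity) y μ ν)
      t ht htr xt z a b α β)
    (fun z _ => by positivity)
    (hInt (N * L) _ m hm r hr hrNL ε hε hεle₀ (small_pull N L U hsmall) hANL t ht htr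
      xt a b α β)
    hsum).trans (le_of_eq ?_)
  -- constants algebra
  field_simp

end Summit.QuantumFields.QCD.Cruxes.InterleavedHeatSliceFlow.Sketch
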